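import Mathlib.Geometry.Manifold.LocalDiffeomorph
import Mathlib.Geometry.Manifold.MFDeriv.Basic
import Mathlib.Geometry.Manifold.MFDeriv.FDeriv
import Mathlib.Geometry.Manifold.MFDeriv.SpecificFunctions
import Mathlib.Geometry.Manifold.ContMDiff.NormedSpace
import Mathlib.Analysis.InnerProductSpace.ConformalLinearMap
import Mathlib.Analysis.Normed.Module.Connected
import Literature.Geometry.Riemannian.ConformallyFlat
import HarnessLib

/-!
# Transition maps of conformally flat coordinates are conformal (proved)

Topic `Literature/Geometry/Riemannian`. Step 1a of Kuiper's theorem (`Literature.Geometry.Riemannian.kuiper`,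
`Literature.Geometry.Riemannian.kuiper_developingMap`; `Literature/Geometry/Riemannian/KuiperProofs.lean`): if
`φ` and `ψ` are two systems of conformally flat coordinates for the metric `g` near a point `x`
(`g = e^{2u} φ^*δ = e^{2u'} ψ^*δ` near `x`, `Literature.Geometry.Lorentzian.PseudoRiemannianMetric.IsConformallyFlatIn`),
then `ψ = τ ∘ φ` near `x` for a map `τ` which is `C^∞` with conformal differential
(`⟪dτ a, dτ b⟫ = e^{2(u - u')} ⟪a, b⟫`) on a connected open neighbourhood of `φ x` — the input of
Liouville's theorem (`Literature.Geometry.Conformal.liouville`, `n ≥ 3`), which then says that `τ` is the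
restriction of a Möbius transformation (Kuiper 1949; Benedetti–Petronio 1992, §B.1 p. 45: a
conformally flat manifold is an `(Sⁿ, Möb(n))`-manifold).

Everything here is PROVED (no named facts):

* `IsConformallyFlatIn.eventually`, `isOpen_setOf_isConformallyFlatIn`: the set of points at
  which given coordinates `(φ, u)` are conformally flat coordinates is open;
* `IsConformallyFlatIn.exists_conformal_transition`: the factorisation `ψ = τ ∘ φ` near `x`
  with `τ` smooth and conformal on a connected open neighbourhood of `φ x`.

## References

* N. H. Kuiper, *On conformally-flat spaces in the large*, Ann. of Math. (2) 50 (1949) 916–924,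
  Theorem p. 917 (not held; locator as in `Kuiper.lean`).
* A. L. Besse, *Einstein Manifolds*, Springer 1987, 1.164 (definition of conformal flatness),
  1.171 (Kuiper's theorem; PDF p. 151, read).
* R. Benedetti, C. Petronio, *Lectures on Hyperbolic Geometry*, Springer 1992 (read): §A.3
  pp. 13–14 (conformal maps: `d_x f` a positive multiple of an isometry), Thm. A.3.7 p. 21
  (Liouville), §B.1 p. 45 (`(X, G)`-structures: transition maps locally in `G`).
-/

noncomputable section

open Manifold Bundle Set Filter Function
open scoped ContDiff Topology RealInnerProductSpace

namespace Literature.Geometry.Riemannian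

section PseudoRiemannianMetric
open Literature.Geometry.Lorentzian (PseudoRiemannianMetric)
open Literature.Geometry.Lorentzian.PseudoRiemannianMetric

variable {E : Type*} [NormedAddCommGroup E] [InnerProductSpace ℝ E] {H : Type*}
  [TopologicalSpace H] {I : ModelWithCorners ℝ E H} {n : ℕ∞ω} {M : Type*} [TopologicalSpace M]
  [ChartedSpace H M] [IsManifold I ∞ M]
  {g : PseudoRiemannianMetric I n E (TangentSpace I : M → Type _)} {x₀ x : M}
  {φ ψ : M → E} {u u' : M → ℝ}

/-! ### Openness of the conformally-flat-coordinate condition -/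

omit [IsManifold I ∞ M] in
/-- A `C^n` local diffeomorphism at `x₀` is a local diffeomorphism at all nearby points (kept in
the project namespace rather than Mathlib's `IsLocalDiffeomorphAt`). [folklore] -/
theorem _root_.Literature.Geometry.Lorentzian.PseudoRiemannianMetric.eventually_isLocalDiffeomorphAt {E' : Type*} [NormedAddCommGroup E']
    [NormedSpace ℝ E'] {H' : Type*} [TopologicalSpace H'] {J : ModelWithCorners ℝ E' H'}
    {N : Type*} [TopologicalSpace N] [ChartedSpace H' N] {m : ℕ∞ω} {f : M → N}
    (hf : IsLocalDiffeomorphAt I J m f x₀) : ∀ᶠ x in 𝓝 x₀, IsLocalDiffeomorphAt I J m f x := by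
  obtain ⟨Φ, hx₀, hΦ⟩ := hf
  filter_upwards [Φ.open_source.mem_nhds hx₀] with x hx
  exact ⟨Φ, hx, hΦ⟩

/-- Conformally flat coordinates at `x₀` are conformally flat coordinates at every nearby point.
[cite: Besse1987, Def. 1.164] -/
theorem _root_.Literature.Geometry.Lorentzian.PseudoRiemannianMetric.IsConformallyFlatIn.eventually (h : g.IsConformallyFlatIn x₀ φ u) :
    ∀ᶠ x in 𝓝 x₀, g.IsConformallyFlatIn x φ u := by
  filter_upwards [eventually_isLocalDiffeomorphAt h.1, eventually_eventually_nhds.2 h.2] with x hx hx'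
  exact ⟨hx, hx'⟩

variable (g φ u) in
/-- The set of points at which `(φ, u)` are conformally flat coordinates for `g` is open.
[cite: Besse1987, Def. 1.164] -/
theorem _root_.Literature.Geometry.Lorentzian.PseudoRiemannianMetric.isOpen_setOf_isConformallyFlatIn : IsOpen {x : M | g.IsConformallyFlatIn x φ u} := by
  simp only [isOpen_iff_mem_nhds, mem_setOf_eq]
  exact fun x hx => hx.eventually

/-! ### The transition map -/

section Transition

/-- **Transition maps of conformally flat coordinates are conformal.** If `(φ, u)` and
`(ψ, u')` are conformally flat coordinates for `g` at `x` (`g = e^{2u} φ^*⟪·,·⟫ = e^{2u'} ψ^*⟪·,·⟫`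
near `x`), then `ψ = τ ∘ φ` near `x` for a map `τ : E → E` (namely `ψ ∘ φ⁻¹`) which, on some
connected open neighbourhood `U` of `φ x`, is `C^∞` with conformal differential at every point
(indeed `⟪dτ a, dτ b⟫ = e^{2(u - u')} ⟪a, b⟫`). This is the statement that a locally
conformally flat manifold carries an atlas into `ℝⁿ` with conformal transition maps
(Kuiper 1949; with Liouville's theorem, Benedetti–Petronio 1992 Thm. A.3.7 p. 21, the
transition maps are Möbius for `n ≥ 3`, i.e. one has an `(Sⁿ, Möb(n))`-structure in the sense
of Benedetti–Petronio §B.1 p. 45).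
[cite: Besse1987, Def. 1.164] [cite: BenedettiPetronio1992, §A.3 pp. 13–14 and §B.1 p. 45] -/
theorem _root_.Literature.Geometry.Lorentzian.PseudoRiemannianMetric.IsConformallyFlatIn.exists_conformal_transition (hφ : g.IsConformallyFlatIn x φ u)
    (hψ : g.IsConformallyFlatIn x ψ u') :
    ∃ (U : Set E) (τ : E → E), IsOpen U ∧ IsConnected U ∧ φ x ∈ U ∧ ContDiffOn ℝ ∞ τ U ∧
      (∀ y ∈ U, IsConformalMap (fderiv ℝ τ y)) ∧ (fun z => τ (φ z)) =ᶠ[𝓝 x] ψ := by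
  -- the local inverse `e` of `φ` at `x` and a partial diffeomorphism `Ψ` representing `ψ`
  set e := hφ.1.localInverse with he_def
  obtain ⟨Ψ, hxΨ, hψΨ⟩ := hψ.1
  have hxe : x ∈ e.target := hφ.1.localInverse_mem_target
  have hφxe : φ x ∈ e.source := hφ.1.localInverse_mem_source
  -- `φ = e.symm` on `e.target`, so `φ` is smooth there
  have hφe : EqOn φ e.symm e.target := by
    intro z hz
    have h1 : e.symm z ∈ e.source := e.toPartialEquiv.map_target hz
    have h2 : e (e.symm z) = z := e.toPartialEquiv.right_inv hz
    conv_lhs => rw [← h2]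
    exact hφ.1.localInverse_right_inv h1
  have hφs : ContMDiffOn I 𝓘(ℝ, E) ∞ φ e.target := e.contMDiffOn_invFun.congr hφe
  have hψs : ContMDiffOn I 𝓘(ℝ, E) ∞ ψ Ψ.source := Ψ.contMDiffOn_toFun.congr hψΨ
  -- the open set `W ∋ x` where both coordinate expressions of `g` hold
  obtain ⟨W, hWsub, hWo, hxW⟩ := mem_nhds_iff.1 (hφ.2.and hψ.2)
  -- the open set `U₁ ∋ φ x` on which `τ := ψ ∘ e` is smooth and conformal
  set τ : E → E := ψ ∘ e with hτ_def
  set U₁ : Set E := e.source ∩ e ⁻¹' (e.target ∩ Ψ.source ∩ W) with hU₁_def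
  have hU₁o : IsOpen U₁ :=
    e.toOpenPartialHomeomorph.isOpen_inter_preimage ((e.open_target.inter Ψ.open_source).inter hWo)
  have hxU₁ : φ x ∈ U₁ := by
    refine ⟨hφxe, ?_⟩
    simp only [mem_preimage]
    rw [hφ.1.localInverse_left_inv hxe]
    exact ⟨⟨hxe, hxΨ⟩, hxW⟩
  -- smoothness of `τ` on `U₁`
  have hτs : ContDiffOn ℝ ∞ τ U₁ := by
    rw [← contMDiffOn_iff_contDiffOn]
    refine hψs.comp (e.contMDiffOn_toFun.mono inter_subset_left) ?_
    rintro y ⟨-, ⟨⟨-, hy⟩, -⟩⟩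
    exact hy
  -- conformality of `dτ` on `U₁`
  have hτc : ∀ y ∈ U₁, IsConformalMap (fderiv ℝ τ y) := by
    rintro y ⟨hy, ⟨⟨hzt, hzΨ⟩, hzW⟩⟩
    obtain ⟨hWφ, hWψ⟩ := hWsub hzW
    -- differentiability
    have hed : MDifferentiableAt 𝓘(ℝ, E) I e y :=
      (e.contMDiffOn_toFun.contMDiffAt (e.open_source.mem_nhds hy)).mdifferentiableAt (by simp)
    have hφd : MDifferentiableAt I 𝓘(ℝ, E) φ (e y) :=
      (hφs.contMDiffAt (e.open_target.mem_nhds hzt)).mdifferentiableAt (by simp)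
    have hψd : MDifferentiableAt I 𝓘(ℝ, E) ψ (e y) :=
      (hψs.contMDiffAt (Ψ.open_source.mem_nhds hzΨ)).mdifferentiableAt (by simp)
    -- `dφ ∘ de = id`
    have hid : φ ∘ e =ᶠ[𝓝 y] id :=
      eventuallyEq_of_mem (e.open_source.mem_nhds hy) fun y' hy' => hφ.1.localInverse_right_inv hy'
    have h1 : mfderiv 𝓘(ℝ, E) 𝓘(ℝ, E) (φ ∘ e) y =
        (mfderiv I 𝓘(ℝ, E) φ (e y)).comp (mfderiv 𝓘(ℝ, E) I e y) := mfderiv_comp y hφd hed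
    rw [hid.mfderiv_eq, mfderiv_id] at h1
    have hAB : ∀ a : E, coordDeriv (I := I) φ (e y) (mfderiv 𝓘(ℝ, E) I e y a) = a := fun a =>
      (DFunLike.congr_fun h1 a).symm
    -- `dτ = dψ ∘ de`
    have hτd : fderiv ℝ τ y = (mfderiv I 𝓘(ℝ, E) ψ (e y)).comp (mfderiv 𝓘(ℝ, E) I e y) := by
      have h2 : mfderiv 𝓘(ℝ, E) 𝓘(ℝ, E) (ψ ∘ e) y =
          (mfderiv I 𝓘(ℝ, E) ψ (e y)).comp (mfderiv 𝓘(ℝ, E) I e y) := mfderiv_comp y hψd hed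
      rw [← h2, hτ_def]
      exact mfderiv_eq_fderiv.symm
    -- the conformal factor of `dψ`, read backwards
    have key : ∀ v w : TangentSpace I (e y),
        ⟪coordDeriv (I := I) ψ (e y) v, coordDeriv (I := I) ψ (e y) w⟫ =
          Real.exp (-(2 * u' (e y))) * g.val (e y) v w := by
      intro v w
      rw [hWψ v w, Real.exp_neg, ← mul_assoc, inv_mul_cancel₀ (Real.exp_pos _).ne', one_mul]
    rw [isConformalMap_iff]
    refine ⟨Real.exp (-(2 * u' (e y))) * Real.exp (2 * u (e y)), by positivity, fun a b => ?_⟩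
    have h3 : ∀ a : E, fderiv ℝ τ y a = coordDeriv (I := I) ψ (e y) (mfderiv 𝓘(ℝ, E) I e y a) :=
      fun a => by rw [hτd]; rfl
    rw [h3, h3, key, hWφ, hAB, hAB]
    ring
  -- a ball inside `U₁`
  obtain ⟨r, hr, hball⟩ := Metric.isOpen_iff.1 hU₁o (φ x) hxU₁
  refine ⟨Metric.ball (φ x) r, τ, Metric.isOpen_ball,
    ⟨⟨φ x, Metric.mem_ball_self hr⟩, Metric.isPreconnected_ball⟩, Metric.mem_ball_self hr,
    hτs.mono hball, fun y hy => hτc y (hball hy), ?_⟩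
  filter_upwards [e.open_target.mem_nhds hxe] with z hz
  change ψ (e (φ z)) = ψ z
  rw [hφ.1.localInverse_left_inv hz]

end Transition

end PseudoRiemannianMetric

end Literature.Geometry.Riemannian

end
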